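import Summits.QuantumFields.BalabanUV.T4Continuum.Support.NE7CornerBumpFlatProjection
import HarnessLib

/-!
# NE7CornerBumpFlatLHCIUnique — UNIQUENESS OF THE LANDAU-HARMONIC CORNER INTERPOLATION OF THE BUMP CLASS AT THE FLAT BACKGROUND: a POINTED skew periodic
# generator whose Laplacian is `hsR`-orthogonal to `Δ_1 T^ρ` has zero Laplacian — F90's letter `hUniq` DISCHARGED at `W = 1` for the bump class; file 29

Cell `pub-balaban`, rung (B)+1 sub-cell t4, lineage `b2b-balaban-t4-ne7-p1` (CRUX PROVER NE7 #1 = OWNER of row NE7), generation 78; memo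
`t4/b2b-balaban-t4-ne7-p1-g78/BUMP-CLASS-FLAT.md` §3.  File F98 (over F97 `NE7CornerBumpFlatProjection`, F96, F95, row NE3's flat dictionary).
WHY (memo §3).  F90's third letter `hUniq` for a test class `T`: a pointed (`μ(M•w) = 0`), skew, periodic `μ` with `Σ hsR (Δμ)(Δν) = 0` for all `ν ∈ T` has `Δμ = 0`.
For the bump class at `W = 1`: `f := Δ_1²μ` is `hsR`-orthogonal to `T^ρ` (summation by parts), so F97's explicit projection writes `f = Φ_{LLρ}C₁ + Φ_ρC₂`
(`C₁` off the corner class of `0`, `C₂` on it).  Summing over the period kills `f` and `Φ_{LLρ}C₁ = Δ_1²(Φ_ρC₁)`, leaving `(Σρ)·‖C₂(0)‖² = 0`: `C₂ = 0`.  Then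
`Δ_1²(μ − Φ_ρC₁) = 0 ⇒ Δ_1(μ − Φ_ρC₁) = 0 ⇒ μ − Φ_ρC₁` is constant (F97's rigidity helpers); comparing the corners `M•w` and `0` (`μ` pointed, `C₁(0) = 0`,
`Φ_ρC₁(M•w) = ρ(s)•C₁(w)`, `ρ(s) > 0`) gives `C₁ = 0`, whence `Δ_1μ = 0`.
WHAT ([folklore]; 0 def, 0 sorry; profile∕shift∕class by equational hypotheses as in F96∕F97).  **`lhci_unique_flatCfg_bump`** — F90's `hUniq` at `W = flatCfg` for
the bump class (`M ≥ 8`, `N ≥ 1`).  With F96 (`hI`∕`hIR`) this closes the LHCI of the bump class at the flat background; the Galerkin letters of the class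
(`hGal`, `hGalR`) and the docking into F89∕F90 follow (files 30+).
HONEST FRAMING (page 1): lattice linear algebra at the TRIVIAL background; the LHCI at curved `W`, the Galerkin letters, (L1)′, α₁, (L2) are NOT here; nothing of
Bałaban's asserted; (APE) NOT proved; NOT ONE-STEP, NOT NE7; spine 0∕9; finite T⁴ rung (B)+1 — NOT infinite volume, NOT mass gap, NOT `BetaPertH`, NOT Clay.
Continuum YM on T⁴ ⇐ BetaPertH ∧ nine spine estimates (0/9 proved); BetaPertH ⇐ (D1) ∧ (D4) ∧ CAP+tail; G-an2-4 gates asym, D1 and NE2/3/4.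
-/

set_option autoImplicit false

open scoped BigOperators Matrix Matrix.Norms.L2Operator
open NormedSpace Finset

namespace Summit.QuantumFields.BalabanUV.T4Continuum.NE7CornerBumpFlatLHCIUnique

open Literature.MathematicalPhysics.QuantumFieldTheory.Balaban1983to89
open B7Prop1Explicit B7Prop2Explicit MatrixNorms
open T4AveragingDeficitWall (IsUnitaryCfg)
open T4AveragingDeficitWallBoundary (IsPeriodicCfg periodBox mem_periodBox)
open MinimalActionWitness (flatCfg isPeriodicCfg_flatCfg)
open BlockAveragePushDirGauge (gaugeDir)
open SmoothRefineBlocks (blk res)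
open NE3CovariantCalculus (hsR hsR_self hsR_sub_left hsR_sum_left)
open NE3FrameFreeDecompositionPrep (hsR_smul_right)
open NE3LandauOrbit (hsR_zero_left eq_zero_of_nhsNormSq_eq_zero)
open NE3FlatHessianCurl (isUnitaryCfg_flatCfg)
open NE3.PairLandauB8 (covLapSite)
open NE3.LandauProjectionB8 (covLapSite_add_period)
open NE3.LandauCorrectionSupB8FlatUnit (sum_covLapSite_flatCfg_eq_zero)
open NE3.FlatBlockHarmonicInverse (sum_hsR_covLapSite_comm)
open NE7PinnedLandauLettersOfLHCI (covLapSite_sub')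
open NE7ProfileFieldFlat (profS_add_period profS_corner covLapSite_flatCfg_profS sum_hsR_profS)
open NE7CornerBumpFlatLHCI (rho_boundaryFree rho_mid_pos corner_datum_class_zero covLapSite_flatCfg_const)
open NE7CornerBumpFlatProjection (eq_smul_ediv_of_dvd eq_zero_of_mem_periodBox_of_dvd lapRho_boundaryFree sum_rho_pos covLapSite_flatCfg_mem_skew
  covLapSite_flatCfg_eq_zero_of_sq const_of_covLapSite_flatCfg_eq_zero bump_projection_flatCfg)

noncomputable section

variable {d : ℕ} {n : Type*} [Fintype n] [DecidableEq n]

/-- **UNIQUENESS OF THE LANDAU-HARMONIC CORNER INTERPOLATION OF THE BUMP CLASS AT THE FLAT BACKGROUND** — F90's letter `hUniq` at `W = flatCfg`: for the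
bump class `T^ρ` (membership characterised by clauses (i)∕(ii) through `hT`), a POINTED skew `(N·M)`-periodic generator `μ` with `Σ hsR (Δ_1μ)(Δ_1ν) = 0` for
every skew periodic `ν ∈ T^ρ` has `Δ_1μ = 0` (`M ≥ 8`, `N ≥ 1`). [folklore] -/
theorem lhci_unique_flatCfg_bump {M N : ℕ} (hM : 8 ≤ M) (hN : 1 ≤ N) {ψ : ℤ → ℝ}
    (hψ : ∀ t : ℤ, ψ t = if 2 ≤ t ∧ t ≤ (M : ℤ) - 2 then (((t : ℝ) - 2) * ((M : ℝ) - 2 - t)) ^ 2 else 0)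
    {ρ : Site d → ℝ} (hρ : ∀ r, ρ r = ∏ i, ψ (r i)) {s : Site d} (hs : s = fun _ => ((M / 2 : ℕ) : ℤ))
    (T : (Site d → Matrix n n ℂ) → Prop)
    (hT : ∀ nu : Site d → Matrix n n ℂ, T nu ↔
      ((∀ C : Site d → Matrix n n ℂ, (∀ w, C w ∈ skewAdjoint (Matrix n n ℂ)) → (∀ (w : Site d) (i : Fin d), C (w + (N : ℤ) • e i) = C w) →
          (∀ w : Site d, C ((N : ℤ) • w) = 0) →
          ∑ y ∈ periodBox (d := d) (N * M), hsR ((fun x => ρ (res M (x + s)) • C (blk M (x + s))) y)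
            (covLapSite (flatCfg (d := d) (n := n)) (covLapSite (flatCfg (d := d) (n := n)) nu) y) = 0) ∧
       (∀ C : Site d → Matrix n n ℂ, (∀ w, C w ∈ skewAdjoint (Matrix n n ℂ)) → (∀ (w : Site d) (i : Fin d), C (w + (N : ℤ) • e i) = C w) →
          (∀ w : Site d, (¬ ∀ i, (N : ℤ) ∣ w i) → C w = 0) →
          ∑ y ∈ periodBox (d := d) (N * M), hsR ((fun x => ρ (res M (x + s)) • C (blk M (x + s))) y) (nu y) = 0))) :
    ∀ mu : Site d → Matrix n n ℂ, (∀ y, mu y ∈ skewAdjoint (Matrix n n ℂ)) →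
      (∀ (y : Site d) (i : Fin d), mu (y + ((N * M : ℕ) : ℤ) • e i) = mu y) → (∀ w : Site d, mu (((M : ℕ) : ℤ) • w) = 0) →
      (∀ nu : Site d → Matrix n n ℂ, (∀ y, nu y ∈ skewAdjoint (Matrix n n ℂ)) →
          (∀ (y : Site d) (i : Fin d), nu (y + ((N * M : ℕ) : ℤ) • e i) = nu y) → T nu →
        ∑ y ∈ periodBox (d := d) (N * M), hsR (covLapSite (flatCfg (d := d) (n := n)) mu y) (covLapSite (flatCfg (d := d) (n := n)) nu y) = 0) →
      ∀ y, covLapSite (flatCfg (d := d) (n := n)) mu y = 0 := by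
  intro mu hmus hmuP hmu0 horth
  have hM1 : 1 ≤ M := by omega
  have hP : 1 ≤ N * M := Nat.mul_pos (by omega) (by omega)
  have hWP : IsPeriodicCfg (flatCfg (d := d) (n := n)) ((N * M : ℕ) : ℤ) := isPeriodicCfg_flatCfg _
  have hρs : 0 < ρ s := by rw [hs]; exact rho_mid_pos hM hψ hρ
  have hs0 : ∀ i, 0 ≤ s i := fun i => by simp only [hs]; positivity
  have hs1 : ∀ i, s i < M := fun i => by
    simp only [hs]; exact_mod_cast (Nat.div_lt_self (by omega) (by norm_num) : M / 2 < M)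
  set Δ : (Site d → Matrix n n ℂ) → Site d → Matrix n n ℂ := covLapSite (flatCfg (d := d) (n := n)) with hΔ
  set Lρ : Site d → ℝ := fun r => ∑ ν : Fin d, (2 * ρ r - ρ (r - e ν) - ρ (r + e ν)) with hLρ
  set LLρ : Site d → ℝ := fun r => ∑ ν : Fin d, (2 * Lρ r - Lρ (r - e ν) - Lρ (r + e ν)) with hLLρ
  have hρbf : ∀ r : Site d, ρ r ≠ 0 → ∀ i, 1 ≤ r i ∧ r i ≤ (M : ℤ) - 2 := rho_boundaryFree hψ hρ
  have hLρbf : ∀ r : Site d, Lρ r ≠ 0 → ∀ i, 1 ≤ r i ∧ r i ≤ (M : ℤ) - 2 := fun r hr => lapRho_boundaryFree hψ hρ r hr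
  have hperΔ : ∀ {g : Site d → Matrix n n ℂ}, (∀ (y : Site d) (i : Fin d), g (y + ((N * M : ℕ) : ℤ) • e i) = g y) →
      ∀ (y : Site d) (i : Fin d), Δ g (y + ((N * M : ℕ) : ℤ) • e i) = Δ g y := fun hg => covLapSite_add_period hWP hg
  -- `f := Δ²μ` is orthogonal to the class
  set f : Site d → Matrix n n ℂ := Δ (Δ mu) with hf
  have hΔmuP := hperΔ hmuP
  have hfP : ∀ (y : Site d) (i : Fin d), f (y + ((N * M : ℕ) : ℤ) • e i) = f y := hperΔ hΔmuP
  have hfs : ∀ y, f y ∈ skewAdjoint (Matrix n n ℂ) := covLapSite_flatCfg_mem_skew (covLapSite_flatCfg_mem_skew hmus)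
  have hforth : ∀ nu : Site d → Matrix n n ℂ, (∀ y, nu y ∈ skewAdjoint (Matrix n n ℂ)) →
      (∀ (y : Site d) (i : Fin d), nu (y + ((N * M : ℕ) : ℤ) • e i) = nu y) → T nu →
      ∑ y ∈ periodBox (d := d) (N * M), hsR (f y) (nu y) = 0 := by
    intro nu hnus hnuP hnuT
    rw [hf, sum_hsR_covLapSite_comm hP hΔmuP hnuP]
    exact horth nu hnus hnuP hnuT
  obtain ⟨C₁, C₂, -, hC₁P, hC₁0, -, hC₂P, hC₂0, hdec, -, -⟩ :=
    bump_projection_flatCfg hM hN hψ hρ hs hLρ hLLρ T hT hfs hfP hforth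
  -- the two profile fields of the decomposition; `Φ₁ = Δ²(Φ_ρ C₁)`
  set Φ₁ : Site d → Matrix n n ℂ := fun x => LLρ (res M (x + s)) • C₁ (blk M (x + s)) with hΦ₁
  set Φ₂ : Site d → Matrix n n ℂ := fun x => ρ (res M (x + s)) • C₂ (blk M (x + s)) with hΦ₂
  set Φρ₁ : Site d → Matrix n n ℂ := fun x => ρ (res M (x + s)) • C₁ (blk M (x + s)) with hΦρ₁
  have hfk : ∀ y, f y = Φ₁ y + Φ₂ y := fun y => by simpa only [hΦ₁, hΦ₂] using hdec y
  have hΦρ₁P : ∀ (y : Site d) (i : Fin d), Φρ₁ (y + ((N * M : ℕ) : ℤ) • e i) = Φρ₁ y := profS_add_period hM1 s ρ hC₁P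
  have hΦ₁eq : Φ₁ = Δ (Δ Φρ₁) := by
    have e1 : Δ Φρ₁ = fun x => Lρ (res M (x + s)) • C₁ (blk M (x + s)) := funext fun y => covLapSite_flatCfg_profS hM1 s hρbf C₁ y
    have e2 : Δ (fun x => Lρ (res M (x + s)) • C₁ (blk M (x + s))) = fun x => LLρ (res M (x + s)) • C₁ (blk M (x + s)) :=
      funext fun y => covLapSite_flatCfg_profS hM1 s hLρbf C₁ y
    rw [e1, e2]
  -- STEP B (1): `C₂ = 0` — pair `Φ₂ = f − Φ₁` with the constant `C₂ 0`
  have hC₂zero : C₂ 0 = 0 := by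
    set X : Matrix n n ℂ := C₂ 0 with hX
    have hconstP : ∀ (y : Site d) (i : Fin d), (fun _ : Site d => X) (y + ((N * M : ℕ) : ℤ) • e i) = (fun _ : Site d => X) y := fun _ _ => rfl
    have h1 : ∑ y ∈ periodBox (d := d) (N * M), hsR (Φ₂ y) X = (∑ r ∈ periodBox (d := d) M, ρ r) * nhsNormSq X := by
      have e := sum_hsR_profS hM1 hN s ρ C₂ (F := fun _ : Site d => X) hconstP hC₂P
      simp only at e
      rw [hΦ₂]; simp only; rw [e]
      have hin : ∀ w ∈ periodBox (d := d) N, hsR (C₂ w) (∑ r ∈ periodBox (d := d) M, ρ r • X)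
          = if w = 0 then (∑ r ∈ periodBox (d := d) M, ρ r) * nhsNormSq X else 0 := by
        intro w hw
        split_ifs with h0
        · rw [h0, ← Finset.sum_smul, hsR_smul_right, ← hX, hsR_self]
        · have hw' : ¬ ∀ i, (N : ℤ) ∣ w i := fun hd => h0 (eq_zero_of_mem_periodBox_of_dvd hw hd)
          rw [hC₂0 w hw', hsR_zero_left]
      rw [Finset.sum_congr rfl hin, Finset.sum_ite_eq' (periodBox (d := d) N) (0 : Site d), if_pos]
      exact mem_periodBox.mpr fun _ => ⟨le_rfl, by simp only [Pi.zero_apply]; exact_mod_cast (by omega : 0 < N)⟩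
    have h2 : ∑ y ∈ periodBox (d := d) (N * M), hsR (Φ₂ y) X = 0 := by
      have e : ∀ y, Φ₂ y = f y - Φ₁ y := fun y => by rw [hfk y]; abel
      simp_rw [e, hsR_sub_left]
      rw [Finset.sum_sub_distrib, ← hsR_sum_left, ← hsR_sum_left]
      have hz1 : ∑ y ∈ periodBox (d := d) (N * M), f y = 0 := by rw [hf]; exact sum_covLapSite_flatCfg_eq_zero hP hΔmuP
      have hz2 : ∑ y ∈ periodBox (d := d) (N * M), Φ₁ y = 0 := by
        rw [hΦ₁eq]; exact sum_covLapSite_flatCfg_eq_zero hP (hperΔ hΦρ₁P)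
      rw [hz1, hz2, hsR_zero_left, sub_zero]
    have h3 : (∑ r ∈ periodBox (d := d) M, ρ r) * nhsNormSq X = 0 := by rw [← h1, h2]
    rcases mul_eq_zero.mp h3 with h4 | h4
    · exact absurd h4 (sum_rho_pos hM hψ hρ).ne'
    · exact eq_zero_of_nhsNormSq_eq_zero h4
  have hC₂all : ∀ w, C₂ w = 0 := by
    intro w
    by_cases hw : ∀ i, (N : ℤ) ∣ w i
    · rw [eq_smul_ediv_of_dvd hw, corner_datum_class_zero hC₂P, hC₂zero]
    · exact hC₂0 w hw
  have hΦ₂zero : ∀ y, Φ₂ y = 0 := fun y => by simp only [hΦ₂, hC₂all, smul_zero]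
  -- STEP B (2): `h := μ − Φ_ρ C₁` has `Δ²h = 0`, hence `Δh = 0`, hence is constant
  set h : Site d → Matrix n n ℂ := fun y => mu y - Φρ₁ y with hh
  have hhP : ∀ (y : Site d) (i : Fin d), h (y + ((N * M : ℕ) : ℤ) • e i) = h y := fun y i => by
    simp only [hh, hmuP y i, hΦρ₁P y i]
  have hΔh : ∀ y, Δ h y = Δ mu y - Δ Φρ₁ y := fun y => covLapSite_sub' _ mu Φρ₁ y
  have hΔΔh : ∀ y, Δ (Δ h) y = 0 := by
    intro y
    have e1 : Δ h = fun y => Δ mu y - Δ Φρ₁ y := funext hΔh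
    have e3 : Δ (fun y => Δ mu y - Δ Φρ₁ y) y = Δ (Δ mu) y - Δ (Δ Φρ₁) y := covLapSite_sub' _ (Δ mu) (Δ Φρ₁) y
    rw [e1, e3]
    have e2 : Δ (Δ Φρ₁) y = Φ₁ y := by rw [hΦ₁eq]
    rw [e2, ← hf, hfk y, hΦ₂zero y, add_zero, sub_self]
  have hΔh0 : ∀ y, Δ h y = 0 := covLapSite_flatCfg_eq_zero_of_sq hP hhP hΔΔh
  have hconst : ∀ v : Site d, h v = h 0 := const_of_covLapSite_flatCfg_eq_zero hP hhP hΔh0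
  -- STEP B (3): comparing the corners `M•w` and `0` gives `C₁ = 0`
  have hC₁zero : C₁ 0 = 0 := by
    have : C₁ ((N : ℤ) • (0 : Site d)) = 0 := hC₁0 0
    simpa using this
  have hcorner : ∀ w : Site d, Φρ₁ ((M : ℤ) • w) = ρ s • C₁ w := fun w => profS_corner hM1 hs0 hs1 ρ C₁ w
  have hmu00 : mu 0 = 0 := by simpa using hmu0 0
  have hΦρ₁0 : Φρ₁ 0 = ρ s • C₁ 0 := by simpa using hcorner 0
  have hh0 : h 0 = 0 := by simp only [hh, hmu00, hΦρ₁0, hC₁zero, smul_zero, sub_zero]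
  have hC₁all : ∀ w, C₁ w = 0 := by
    intro w
    have h1 := hconst ((M : ℤ) • w)
    rw [hh0] at h1
    have h2 : h ((M : ℤ) • w) = -(ρ s • C₁ w) := by
      simp only [hh]
      rw [hcorner w]
      rw [hmu0 w, zero_sub]
    rw [h2, neg_eq_zero] at h1
    exact (smul_eq_zero.mp h1).resolve_left hρs.ne'
  -- conclusion: `Φ_ρ C₁ = 0`, so `Δμ = Δh = 0`
  intro y
  have hΦρ₁zero : Φρ₁ = fun _ => 0 := by funext x; simp only [hΦρ₁, hC₁all, smul_zero]
  have : Δ mu y = Δ h y + Δ Φρ₁ y := by rw [hΔh y]; abel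
  rw [this, hΔh0 y, hΦρ₁zero, zero_add]
  exact covLapSite_flatCfg_const 0 y

end

end Summit.QuantumFields.BalabanUV.T4Continuum.NE7CornerBumpFlatLHCIUnique
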